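import Literature.AlgebraicGeometry.AbelianSchemes.SerreTensorRecognitionOfPoints   -- ★ `flat_left_of_isFinite_of_surjective`; brings ★ `EtaleKernelDecidedOnPoints` §3, ★ `AbelianSchemeHomDescentFlatSurjective`
import Literature.AlgebraicGeometry.Morphisms.GeometricPointsLiftSurjective          -- ★ `exists_over_comp_eq_of_surjective` (Ω-points lift along surjective l.f.t. maps)
import Mathlib.RingTheory.DedekindDomain.Ideal.Lemmas
import HarnessLib

/-!
# The RETURN ISOGENY of a Serre cover and its COFACTOR: from `c : A → A′` with `Ker c = A[𝔞]` and `d_a ∘ c = ι(a)`, a pair `(d_a, g)` with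
# `g ∘ d_a = ι(b)`, `d_a ∘ g = ι(b)` for a scalar `b` prime to a chosen maximal ideal `𝔭` ([Mumford 1970] §7 Thm. 4; [Shimura 1998] §13.1, §18.6)

Topic `Literature/AlgebraicGeometry/AbelianSchemes`; namespace `Literature.AlgebraicGeometry.AbelianSchemes.AbelianSchemeOver`.  THEOREMS ONLY (no definition, no
named fact, no `instance`, no notation, no `sorry`).  Cell `hodgecm-mathlib` (D-0151), FLOOR 0, P6 «MOD programme» (crux hLiu418 = stmt-HodgeConjecture-24832,
`--supports`, count-neutral): organ **(R4)+(R5) «RETURN-ISOGENY COFACTOR»** of line L2 (socket `stub_DOWN`, organ `stub_LAYERISO`, return-isogeny route; LA2-plan (g0)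
02:20:59Z ∕ 02:31:16Z rulings): upstairs (generic fibres over `Ω = Ω̄`, characteristic `0`) the Serre cover `c : A_{e,y} → A_{e′,y}` of the moduli datum (`CoverΩ` (t1)(t4)
+ the kernel clause (t1′) `coverKerΩ` of spine ED. 4) yields, for a scalar `a ∈ 𝔞` of exact `𝔭`-valuation, the return isogeny `d_a` AND a cofactor `g` with
`d_a ≫ g = ι(b)`, `g ≫ d_a = ι(b)`, `b ∉ 𝔭` — the PAIR that ★ `IdealKernelLayerIso.exists_layerIso_of_hom_pair` (§5) turns into the layer isomorphism downstairs after
reduction (★ (ν8) + the composition transfer (ν8b)).  HC_CM is proved only modulo the printed citations (2 remaining named inputs hLiu418 24832, h413 24833) until rung 0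
closes; this file is generic and changes no count.

THE MATHEMATICS ([MumfordAV1970] §7 Thm. 4 p. 72: a homomorphism killing the kernel of an isogeny factors uniquely through it, and the factor is a homomorphism;
[Shimura1998] §13.1 Thm. 1, §18.6: the `𝔞`-multiplications between conjugate fibres).  `A`, `A′` abelian schemes over `Spec Ω` (`Ω` algebraically closed of
characteristic `0`) with ring actions `ι`, `ι′` of a commutative ring `𝒪`; `c : A → A′` an `𝒪`-equivariant homomorphism with `c.left` finite and surjective; `𝔞 ⊆ 𝒪` an
ideal with the KERNEL LAW `t ≫ c = 1 ↔ ∀ a ∈ 𝔞, t ≫ ι(a) = 1` (all `T`-points).  (§1) If `c ≫ d = ι(a)` then `d` is a homomorphism (descent through the flat surjective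
`c`), `𝒪`-equivariant (uniqueness of descent: `c ≫ (ι′(x) ≫ d) = c ≫ (d ≫ ι(x)) = ι(xa)`), surjective if `ι(a)` is, finite if `d ≫ c = ι′(a)` is.  (§2) If `b·𝔞 ⊆ (a)`
then `ι′(b)` kills `Ker d` — on `Ω`-points `t = c(s)` with `a s = 0`, and `b t = c(b s) = 0` because `b s ∈ A[𝔞] = Ker c`; kernels of isogenies in characteristic `0` are
decided on `Ω`-points (★ `comp_eq_one_of_forall_algPoints_of_charZero`) — so `ι′(b) = d ≫ g` for a unique homomorphism `g` (★ `exists_isMonHom_comp_eq_of_forall_comp_eq_one`),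
and `g ≫ d = ι(b)`, `g` equivariant, by uniqueness of descent through `d`.  (§3) For `𝒪` Dedekind, `𝔞 ≠ 0` and `𝔭` maximal there are `a ∈ 𝔞 ∖ 𝔞𝔭` (so `(a) = 𝔞𝔠`
with `𝔠 ⊄ 𝔭`) and `b ∈ 𝔠 ∖ 𝔭`, whence `b𝔞 ⊆ (a)`.  (§4) assembles the pair.

* §1 `isMonHom_of_cover_comp_eq`, `comp_eq_comp_of_cover_comp_eq` (equivariance of `d`), `surjective_left_of_cover_comp_eq`, `isFinite_left_of_comp_cover_eq`;
* §2 `cover_kills_of_kernel_law` (`s ≫ ι(b) ≫ c = 1` for `s ∈ A[(a)]`), `comp_i_eq_one_of_comp_returnIsogeny_eq_one` (`Ker d ≤ Ker ι′(b)` on all `T`-points),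
  **`exists_cofactor_of_kernel_law`**;
* §3 `Ideal.exists_mem_exists_not_mem_mul_subset_span` — the (R4) scalars `a`, `b`;
* §4 HEAD **`exists_returnIsogeny_pair_of_kernel_law`**.

## References
* [MumfordAV1970] D. Mumford, *Abelian Varieties* (1970), §7 Thm. 4 (p. 72).
* [Shimura1998] G. Shimura, *Abelian Varieties with Complex Multiplication and Modular Functions* (1998), §13.1 Theorem 1 (pp. 97–99), §18.6 (pp. 124–127).
* [GortzWedhorn2020] U. Görtz, T. Wedhorn, *Algebraic Geometry I*, 2nd ed. (2020), Cor. 3.36 (p. 83), Definition 4.45 (2) (p. 117).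
-/

set_option autoImplicit false

noncomputable section

universe u

open CategoryTheory CategoryTheory.Limits AlgebraicGeometry MonoidalCategory CartesianMonoidalCategory
open scoped MonObj

namespace Literature.AlgebraicGeometry.AbelianSchemes

namespace AbelianSchemeOver

open Literature.AlgebraicGeometry.Motives (AlgPoints SchemeOver specOver)

variable {Ω : Type u} [Field Ω] {A A' : AbelianSchemeOver (Spec (.of Ω))} {O : Type*} [CommRing O]
  (ρ : A.RingAction O) (ρ' : A'.RingAction O) (c : A.X ⟶ A'.X) [IsMonHom c]

/-! ## §1 The return isogeny `d` of `c ≫ d = ι(a)` -/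

/-- **The return isogeny is a homomorphism**: if `c ≫ d = ι(a)` with `c.left` finite surjective (hence flat), then `d` is a homomorphism (descent through `c`).
[cite: MumfordAV1970, §7 Thm. 4 (p. 72)] -/
theorem isMonHom_of_cover_comp_eq [IsFinite c.left] [Surjective c.left] (d : A'.X ⟶ A.X) (a : O) (hcd : c ≫ d = ρ.i a) : IsMonHom d := by
  haveI := ρ.isMonHom a
  haveI : Flat c.left := flat_left_of_isFinite_of_surjective c
  exact A.isMonHom_of_comp_eq c (ρ.i a) hcd

/-- **The return isogeny is `𝒪`-equivariant** (`c` equivariant, `𝒪` commutative): `ι′(x) ≫ d = d ≫ ι(x)` — both are the descent through `c` of `ι(a) ≫ ι(x) = ι(x) ≫ ι(a)`.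
[cite: MumfordAV1970, §7 Thm. 4 (p. 72)] -/
theorem comp_eq_comp_of_cover_comp_eq [IsFinite c.left] [Surjective c.left] (hc : ∀ x, ρ.i x ≫ c = c ≫ ρ'.i x)
    (d : A'.X ⟶ A.X) (a : O) (hcd : c ≫ d = ρ.i a) (x : O) : ρ'.i x ≫ d = d ≫ ρ.i x := by
  haveI := ρ.isMonHom
  haveI := ρ'.isMonHom
  haveI : IsMonHom d := isMonHom_of_cover_comp_eq ρ c d a hcd
  haveI : Flat c.left := flat_left_of_isFinite_of_surjective c
  have hker : ∀ ⦃T : Over (Spec (.of Ω))⦄ (t : T ⟶ A.X), t ≫ c = 1 → t ≫ (ρ.i a ≫ ρ.i x) = 1 := fun T t ht => by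
    rw [← hcd, ← Category.assoc, ← Category.assoc, ht, MonObj.one_comp, MonObj.one_comp]
  obtain ⟨χ, -, huniq⟩ := A.existsUnique_comp_eq_of_forall_comp_eq_one c (ρ.i a ≫ ρ.i x) hker
  have h1 : c ≫ (ρ'.i x ≫ d) = ρ.i a ≫ ρ.i x := by
    rw [← Category.assoc, ← hc, Category.assoc, hcd, ← ρ.i_mul, ← ρ.i_mul, mul_comm]
  have h2 : c ≫ (d ≫ ρ.i x) = ρ.i a ≫ ρ.i x := by rw [← Category.assoc, hcd]
  rw [huniq _ h1, huniq _ h2]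

omit [IsMonHom c] in
/-- `d.left` is surjective when `c ≫ d = ι(a)` and `ι(a).left` is. [cite: MumfordAV1970, §7 Thm. 4 (p. 72)] -/
theorem surjective_left_of_cover_comp_eq (d : A'.X ⟶ A.X) (a : O) (hcd : c ≫ d = ρ.i a) [Surjective (ρ.i a).left] : Surjective d.left := by
  have h : (c ≫ d).left = c.left ≫ d.left := Over.comp_left _ _ _ _ _
  have hs : Function.Surjective (c.left ≫ d.left).base := by
    rw [← h, hcd]
    exact (inferInstance : Surjective (ρ.i a).left).surj
  rw [Scheme.Hom.comp_base] at hs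
  exact ⟨Function.Surjective.of_comp hs⟩

omit [IsMonHom c] in
/-- `d.left` is finite when `d ≫ c = ι′(a)` and `ι′(a).left` is (`c.left` separated). [cite: MumfordAV1970, §7 Thm. 4 (p. 72)] -/
theorem isFinite_left_of_comp_cover_eq [IsFinite c.left] (d : A'.X ⟶ A.X) (a : O) (hdc : d ≫ c = ρ'.i a) [IsFinite (ρ'.i a).left] : IsFinite d.left := by
  have h : IsFinite (d.left ≫ c.left) := by
    rw [← Over.comp_left, hdc]
    infer_instance
  exact IsFinite.of_comp d.left c.left

/-! ## §2 The cofactor `g` with `d ≫ g = ι′(b)`, `g ≫ d = ι(b)` -/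

omit [IsMonHom c] in
/-- **`ι(b) ≫ c` kills `A[(a)]` when `b𝔞 ⊆ (a)` and `Ker c ⊇ A[𝔞]`**: for a `T`-point `s` with `s ≫ ι(a) = 1`, `(s ≫ ι(b)) ≫ ι(a′) = s ≫ ι(a′b) = s ≫ ι(ra) = 1` for every
`a′ ∈ 𝔞`, so `s ≫ ι(b) ≫ c = 1` by the kernel law. [cite: MumfordAV1970, §7 Thm. 4 (p. 72)] [cite: Shimura1998, §13.1, Theorem 1 (pp. 97–99)] -/
theorem cover_kills_of_kernel_law (𝔞 : Ideal O) (hker : ∀ ⦃T : Over (Spec (.of Ω))⦄ (t : T ⟶ A.X), (∀ a' ∈ 𝔞, t ≫ ρ.i a' = 1) → t ≫ c = 1)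
    {a b : O} (hb : ∀ a' ∈ 𝔞, ∃ r : O, a' * b = r * a) {T : Over (Spec (.of Ω))} (s : T ⟶ A.X) (hs : s ≫ ρ.i a = 1) :
    (s ≫ ρ.i b) ≫ c = 1 := by
  haveI := ρ.isMonHom
  refine hker _ fun a' ha' => ?_
  obtain ⟨r, hr⟩ := hb a' ha'
  rw [Category.assoc, ← ρ.i_mul, hr, ρ.i_mul, ← Category.assoc, hs, MonObj.one_comp]

/-- **`ι′(b)` kills `Ker d` on all `T`-points** (`Ω = Ω̄`, `char Ω = 0`; `c ≫ d = ι(a)`, `d ≫ c = ι′(a)` with `ι(a)`, `ι′(a)` finite surjective; `Ker c ⊇ A[𝔞]`; `b𝔞 ⊆ (a)`):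
decided on `Ω`-points (★ `comp_eq_one_of_forall_algPoints_of_charZero`), where `t = s ≫ c` (★ `exists_over_comp_eq_of_surjective`), `s ≫ ι(a) = t ≫ d = 1` and
`t ≫ ι′(b) = s ≫ ι(b) ≫ c = 1`. [cite: MumfordAV1970, §7 Thm. 4 (p. 72)] [cite: GortzWedhorn2020, Cor. 3.36 (p. 83)] -/
theorem comp_i_eq_one_of_comp_returnIsogeny_eq_one [IsAlgClosed Ω] [CharZero Ω] [IsFinite c.left] [Surjective c.left]
    (hc : ∀ x, ρ.i x ≫ c = c ≫ ρ'.i x) (𝔞 : Ideal O)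
    (hker : ∀ ⦃T : Over (Spec (.of Ω))⦄ (t : T ⟶ A.X), (∀ a' ∈ 𝔞, t ≫ ρ.i a' = 1) → t ≫ c = 1)
    {a b : O} (hb : ∀ a' ∈ 𝔞, ∃ r : O, a' * b = r * a) (d : A'.X ⟶ A.X) (hcd : c ≫ d = ρ.i a) (hdc : d ≫ c = ρ'.i a)
    [IsFinite (ρ'.i a).left] [Surjective (ρ.i a).left]
    ⦃T : Over (Spec (.of Ω))⦄ (t : T ⟶ A'.X) (ht : t ≫ d = 1) : t ≫ ρ'.i b = 1 := by
  haveI : IsMonHom d := isMonHom_of_cover_comp_eq ρ c d a hcd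
  haveI : IsFinite d.left := isFinite_left_of_comp_cover_eq ρ' c d a hdc
  haveI : Surjective d.left := surjective_left_of_cover_comp_eq ρ c d a hcd
  refine comp_eq_one_of_forall_algPoints_of_charZero d (ρ'.i b) (fun P hP => ?_) t ht
  obtain ⟨Q, hQ⟩ := Literature.AlgebraicGeometry.Morphisms.exists_over_comp_eq_of_surjective c
    (Spec.map (CommRingCat.ofHom (algebraMap Ω Ω))) P
  have hQa : Q ≫ ρ.i a = 1 := by rw [← hcd, ← Category.assoc, hQ, hP]
  rw [← hQ, Category.assoc, ← hc, ← Category.assoc]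
  exact cover_kills_of_kernel_law ρ c 𝔞 hker hb Q hQa

/-- **THE COFACTOR** (`Ω = Ω̄`, characteristic `0`): under the hypotheses of `comp_i_eq_one_of_comp_returnIsogeny_eq_one` there is a homomorphism `g : A → A′` with
`d ≫ g = ι′(b)`, `g ≫ d = ι(b)`, and `ι(x) ≫ g = g ≫ ι′(x)` for all `x` (descent through the finite flat surjective `d`, then uniqueness of descent for the two laws).
[cite: MumfordAV1970, §7 Thm. 4 (p. 72)] [cite: Shimura1998, §13.1, Theorem 1 (pp. 97–99); §18.6 (pp. 124–127)] -/
theorem exists_cofactor_of_kernel_law [IsAlgClosed Ω] [CharZero Ω] [IsFinite c.left] [Surjective c.left]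
    (hc : ∀ x, ρ.i x ≫ c = c ≫ ρ'.i x) (𝔞 : Ideal O)
    (hker : ∀ ⦃T : Over (Spec (.of Ω))⦄ (t : T ⟶ A.X), (∀ a' ∈ 𝔞, t ≫ ρ.i a' = 1) → t ≫ c = 1)
    {a b : O} (hb : ∀ a' ∈ 𝔞, ∃ r : O, a' * b = r * a) (d : A'.X ⟶ A.X) (hcd : c ≫ d = ρ.i a) (hdc : d ≫ c = ρ'.i a)
    [IsFinite (ρ'.i a).left] [Surjective (ρ.i a).left] :
    ∃ g : A.X ⟶ A'.X, IsMonHom g ∧ d ≫ g = ρ'.i b ∧ g ≫ d = ρ.i b ∧ ∀ x, ρ.i x ≫ g = g ≫ ρ'.i x := by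
  haveI := ρ.isMonHom
  haveI := ρ'.isMonHom
  haveI : IsMonHom d := isMonHom_of_cover_comp_eq ρ c d a hcd
  haveI : IsFinite d.left := isFinite_left_of_comp_cover_eq ρ' c d a hdc
  haveI : Surjective d.left := surjective_left_of_cover_comp_eq ρ c d a hcd
  haveI : Flat d.left := flat_left_of_isFinite_of_surjective d
  have hdeq : ∀ x, ρ'.i x ≫ d = d ≫ ρ.i x := comp_eq_comp_of_cover_comp_eq ρ ρ' c hc d a hcd
  have hkd : ∀ ⦃T : Over (Spec (.of Ω))⦄ (t : T ⟶ A'.X), t ≫ d = 1 → t ≫ ρ'.i b = 1 :=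
    comp_i_eq_one_of_comp_returnIsogeny_eq_one ρ ρ' c hc 𝔞 hker hb d hcd hdc
  obtain ⟨g, hg, hdg, -⟩ := A'.exists_isMonHom_comp_eq_of_forall_comp_eq_one d (ρ'.i b) hkd
  haveI := hg
  refine ⟨g, hg, hdg, ?_, fun x => ?_⟩
  · -- `g ≫ d` and `ι(b)` both descend `d ≫ ι(b)` through `d`
    have hk : ∀ ⦃T : Over (Spec (.of Ω))⦄ (t : T ⟶ A'.X), t ≫ d = 1 → t ≫ (d ≫ ρ.i b) = 1 := fun T t ht => by
      rw [← Category.assoc, ht, MonObj.one_comp]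
    obtain ⟨χ, -, huniq⟩ := A'.existsUnique_comp_eq_of_forall_comp_eq_one d (d ≫ ρ.i b) hk
    have h1 : d ≫ (g ≫ d) = d ≫ ρ.i b := by rw [← Category.assoc, hdg, hdeq]
    rw [huniq _ h1, huniq _ rfl]
  · -- `ι(x) ≫ g` and `g ≫ ι′(x)` both descend `ι′(bx)` through `d`
    have hk : ∀ ⦃T : Over (Spec (.of Ω))⦄ (t : T ⟶ A'.X), t ≫ d = 1 → t ≫ (ρ'.i x ≫ ρ'.i b) = 1 := fun T t ht => by
      have h := hkd (t ≫ ρ'.i x) (by rw [Category.assoc, hdeq, ← Category.assoc, ht, MonObj.one_comp])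
      rw [← Category.assoc, h]
    obtain ⟨χ, -, huniq⟩ := A'.existsUnique_comp_eq_of_forall_comp_eq_one d (ρ'.i x ≫ ρ'.i b) hk
    have h1 : d ≫ (ρ.i x ≫ g) = ρ'.i x ≫ ρ'.i b := by rw [← Category.assoc, ← hdeq, Category.assoc, hdg]
    have h2 : d ≫ (g ≫ ρ'.i x) = ρ'.i x ≫ ρ'.i b := by
      rw [← Category.assoc, hdg, ← ρ'.i_mul, ← ρ'.i_mul, mul_comm]
    rw [huniq _ h1, huniq _ h2]

/-! ## §3 The scalars: `a ∈ 𝔞` of exact `𝔭`-valuation and a cofactor `b ∉ 𝔭` with `b𝔞 ⊆ (a)` -/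

/-- **(R4) In a Dedekind domain, for `𝔞 ≠ 0` and `𝔭` maximal there are `a ∈ 𝔞`, `a ≠ 0`, and `b ∉ 𝔭` with `b·𝔞 ⊆ (a)`**: take `a ∈ 𝔞 ∖ 𝔞𝔭` (`𝔞𝔭 < 𝔞` by
cancellation), write `(a) = 𝔞𝔠`; then `𝔠 ⊄ 𝔭` (else `a ∈ 𝔞𝔭`) and any `b ∈ 𝔠 ∖ 𝔭` works. [cite: Shimura1998, §13.1, Theorem 1 (pp. 97–99)] -/
theorem _root_.Ideal.exists_mem_exists_not_mem_mul_subset_span {R : Type*} [CommRing R] [IsDedekindDomain R] (𝔞 : Ideal R) (h𝔞 : 𝔞 ≠ ⊥)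
    (𝔭 : Ideal R) [𝔭.IsMaximal] :
    ∃ a ∈ 𝔞, a ≠ 0 ∧ ∃ b : R, b ∉ 𝔭 ∧ ∀ a' ∈ 𝔞, ∃ r : R, a' * b = r * a := by
  have hlt : 𝔞 * 𝔭 < 𝔞 := by
    refine lt_of_le_of_ne Ideal.mul_le_right fun h => ?_
    have h' : 𝔞 * 𝔭 = 𝔞 * 1 := by rw [mul_one]; exact h
    exact Ideal.IsMaximal.ne_top ‹_› ((mul_left_cancel₀ h𝔞 h').trans Ideal.one_eq_top)
  obtain ⟨a, ha, ha'⟩ := SetLike.exists_of_lt hlt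
  have ha0 : a ≠ 0 := by
    rintro rfl
    exact ha' (zero_mem _)
  obtain ⟨𝔠, h𝔠⟩ : 𝔞 ∣ Ideal.span {a} := Ideal.dvd_span_singleton.mpr ha
  have hnc : ¬ 𝔠 ≤ 𝔭 := fun hle => ha' (by
    have : Ideal.span {a} ≤ 𝔞 * 𝔭 := h𝔠 ▸ Ideal.mul_mono_right hle
    exact this (Ideal.mem_span_singleton_self a))
  obtain ⟨b, hb, hb'⟩ := Set.not_subset.mp hnc
  refine ⟨a, ha, ha0, b, hb', fun a' ha'' => ?_⟩
  have hmem : a' * b ∈ Ideal.span {a} := by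
    rw [h𝔠]
    exact Ideal.mul_mem_mul ha'' hb
  obtain ⟨r, hr⟩ := Ideal.mem_span_singleton'.mp hmem
  exact ⟨r, hr.symm⟩

/-! ## §4 HEAD: the return-isogeny pair -/

/-- **THE RETURN-ISOGENY PAIR OF A SERRE COVER** (`Ω = Ω̄` of characteristic `0`; `𝒪` a Dedekind domain acting on `A`, `A′`; `c : A → A′` an equivariant
homomorphism, finite and surjective, with (t1) `∀ a ∈ 𝔞, ∃ d, c ≫ d = ι(a) ∧ d ≫ c = ι′(a)` and the kernel law `Ker c ⊇ A[𝔞]` on all `T`-points; `ι(x)`, `ι′(x)` finite and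
surjective for `x ≠ 0`; `𝔞 ≠ 0`, `𝔭` maximal).  THEN there are `a ∈ 𝔞`, `b ∉ 𝔭` and HOMOMORPHISMS `d : A′ → A`, `g : A → A′`, both `𝒪`-equivariant, finite and
surjective, with `c ≫ d = ι(a)`, `d ≫ c = ι′(a)`, `d ≫ g = ι′(b)`, `g ≫ d = ι(b)` — the input pair of ★ `IdealKernelLayerIso.exists_layerIso_of_hom_pair` (`b` is a unit
modulo `𝔭`). [cite: MumfordAV1970, §7 Thm. 4 (p. 72)] [cite: Shimura1998, §13.1, Theorem 1 (pp. 97–99); §18.6 (pp. 124–127)] -/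
theorem exists_returnIsogeny_pair_of_kernel_law [IsAlgClosed Ω] [CharZero Ω] [IsDedekindDomain O] [IsFinite c.left] [Surjective c.left]
    (hc : ∀ x, ρ.i x ≫ c = c ≫ ρ'.i x) (𝔞 : Ideal O) (h𝔞 : 𝔞 ≠ ⊥) (𝔭 : Ideal O) [𝔭.IsMaximal]
    (ht1 : ∀ a ∈ 𝔞, ∃ d : A'.X ⟶ A.X, c ≫ d = ρ.i a ∧ d ≫ c = ρ'.i a)
    (hker : ∀ ⦃T : Over (Spec (.of Ω))⦄ (t : T ⟶ A.X), (∀ a' ∈ 𝔞, t ≫ ρ.i a' = 1) → t ≫ c = 1)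
    (hρ : ∀ x : O, x ≠ 0 → IsFinite (ρ.i x).left ∧ Surjective (ρ.i x).left)
    (hρ' : ∀ x : O, x ≠ 0 → IsFinite (ρ'.i x).left ∧ Surjective (ρ'.i x).left) :
    ∃ (a : O) (_ : a ∈ 𝔞) (b : O) (_ : b ∉ 𝔭) (d : A'.X ⟶ A.X) (g : A.X ⟶ A'.X),
      IsMonHom d ∧ IsMonHom g ∧ c ≫ d = ρ.i a ∧ d ≫ c = ρ'.i a ∧ d ≫ g = ρ'.i b ∧ g ≫ d = ρ.i b ∧
      (∀ x, ρ'.i x ≫ d = d ≫ ρ.i x) ∧ (∀ x, ρ.i x ≫ g = g ≫ ρ'.i x) ∧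
      IsFinite d.left ∧ Surjective d.left ∧ IsFinite g.left ∧ Surjective g.left := by
  obtain ⟨a, ha, ha0, b, hb𝔭, hb⟩ := 𝔞.exists_mem_exists_not_mem_mul_subset_span h𝔞 𝔭
  obtain ⟨d, hcd, hdc⟩ := ht1 a ha
  have hb0 : b ≠ 0 := by
    rintro rfl
    exact hb𝔭 (zero_mem 𝔭)
  haveI : IsFinite (ρ'.i a).left := (hρ' a ha0).1
  haveI : Surjective (ρ.i a).left := (hρ a ha0).2
  haveI : IsFinite (ρ.i b).left := (hρ b hb0).1
  haveI : Surjective (ρ'.i b).left := (hρ' b hb0).2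
  haveI : IsMonHom d := isMonHom_of_cover_comp_eq ρ c d a hcd
  have hdfin : IsFinite d.left := isFinite_left_of_comp_cover_eq ρ' c d a hdc
  have hdsurj : Surjective d.left := surjective_left_of_cover_comp_eq ρ c d a hcd
  obtain ⟨g, hg, hdg, hgd, hgeq⟩ := exists_cofactor_of_kernel_law ρ ρ' c hc 𝔞 hker hb d hcd hdc
  haveI := hdfin
  exact ⟨a, ha, b, hb𝔭, d, g, inferInstance, hg, hcd, hdc, hdg, hgd, comp_eq_comp_of_cover_comp_eq ρ ρ' c hc d a hcd, hgeq,
    hdfin, hdsurj, isFinite_left_of_comp_cover_eq ρ d g b hgd, surjective_left_of_cover_comp_eq ρ' d g b hdg⟩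

end AbelianSchemeOver

end Literature.AlgebraicGeometry.AbelianSchemes

end
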